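import Summits.RiemannHypothesis.RiemannHypothesis.Theses.ScrewSquaringLaw
import HarnessLib

/-!
# Crux `ScrewSquaringLaw.SquaringNodes` (stmt-RiemannHypothesis-23895) — a floor of the doubling
defect of Suzuki's screw function at the integer nodes is a floor on the continuum (K1′ of route
`ScrewSquaringLaw`, L45 «squaring law»; RH-free bookkeeping)

`Ψ = zetaScrew` is Suzuki's screw function of `ζ` (Suzuki 2023, arXiv:2206.03682, (1.1):
`Ψ(t) = 4(e^{t/2} + e^{-t/2} - 2) - φ(t) - c₀ t/2 + ¼ (C - e^{-t/2} Φ(e^{-2t}, 2, ¼))` for `t ≥ 0`, with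
the prime sum `φ(t) = Σ_{n ≤ e^t} Λ(n) n^{-1/2} (t - log n)`, `c₀ = γ₀ + π/2 + 3 log 2 + log π` and
`C = Σ_{k ≥ 0} (k + ¼)^{-2}`).

**Theorem (`squaringNodes_proof`, the route decl `SquaringNodes` by name).** If for some `K` and every
integer `m ≥ 1`, `Ψ(log m) ≤ 4 Ψ(½ log m) + K` (a floor `-K` of the doubling defect `4Ψ(t) - Ψ(2t)` at the
nodes `t = ½ log m`, i.e. at the scale pairs `x = √m`, `x = m`), then for some `K'` and every real
`t ≥ 0`, `Ψ(2t) ≤ 4 Ψ(t) + K'`.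

**Proof** (the registered line «TwoScaleSlack» of planner rh-idea-7, both stubs proved here).  Two
one-sided oscillation bounds for `Ψ` on `0 ≤ u ≤ t`, read off (1.1) using only `Λ ≥ 0`:
* `zetaScrew_sub_le_of_le` (from above): `Ψ(t) - Ψ(u) ≤ 2 e^{t/2} (t - u) + C/4` — the archimedean part
  rises by at most `4(e^{t/2} - e^{u/2}) ≤ 2 e^{t/2}(t - u)`, `-φ` and the linear term decrease, the
  Hurwitz–Lerch part varies inside `[0, C/4]`;
* `zetaScrew_sub_le_of_le'` (from below): `Ψ(u) - Ψ(t) ≤ (t - u)(2M + 4)` whenever `e^t ≤ M ∈ ℕ` — the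
  archimedean and Hurwitz–Lerch parts are monotone, `φ` rises by at most `(t - u) Σ_{n ≤ M} Λ(n)/√n ≤ (t - u) 2M`
  and the linear term falls by `(t - u) c₀/2 ≤ 4 (t - u)` (the bookkeeping of the tree's
  `IntegerScrewDiscreteLandau.nodeSlack`, with `u` no longer required to be a node).
On the cell `log m ≤ s < log (m+1)` (`m = ⌊e^s⌋`) one has `s - log m ≤ 1/m` against `e^{s/2} < m + 1`, which
gives `stub_upperNodeSlack`: `Ψ(s) ≤ Ψ(log ⌊e^s⌋) + 4 + C/4`; at the half-node `u = ½ log ⌊e^{2t}⌋` one has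
`t - u ≤ 1/(2m)` against `e^{t} < m + 1` (`m = ⌊e^{2t}⌋`), which gives `stub_halfNodeSlack`:
`|Ψ(t) - Ψ(u)| ≤ 4 + C/4`.  Then `Ψ(2t) ≤ Ψ(log m) + C₁ ≤ 4Ψ(½ log m) + K + C₁ ≤ 4Ψ(t) + K + C₁ + 4C₂`
(composition `squaringNodes_proof`, the planner's kernel-checked `SquaringNodes_of`).

HONEST LABEL.  This is RH-free real-variable bookkeeping about `ζ`'s own screw function; it proves the
conjunct K1′ of the route and says NOTHING about the truth of RH (the route's residual `SquaringLaw` is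
RH-implied and, given K1 ∧ K1′, RH-equivalent).  RH is NOT proved by this file.
-/

-- `Summit.RiemannHypothesis.RiemannHypothesis.…` repeats a component by the tree's layout (D-0017).
set_option linter.dupNamespace false

noncomputable section

namespace Summit.RiemannHypothesis.RiemannHypothesis.Theorems.ScrewSquaringLaw

open Literature.NumberTheory.LFunctions

/-! ## The prime sum: monotone and Lipschitz from above -/

/-- One-sided increments of Suzuki's prime sum `φ = zetaScrewPrimeSum`: for `0 ≤ u ≤ t` and `e^t ≤ M`,
`0 ≤ φ(t) - φ(u) ≤ (t - u) · Σ_{1 ≤ n ≤ M} Λ(n)/√n` (truncate both sums at the common cut-off `M`,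
`zetaScrewPrimeSum_eq_sum_max`; each hinge `max(· - log n, 0)` is non-decreasing and `1`-Lipschitz, and
`Λ(n) n^{-1/2} ≥ 0`). -/
theorem zetaScrewPrimeSum_sub_mem_Icc {u t : ℝ} {M : ℕ} (hu : 0 ≤ u) (hut : u ≤ t)
    (htM : Real.exp t ≤ M) :
    zetaScrewPrimeSum t - zetaScrewPrimeSum u ∈
      Set.Icc 0 ((t - u) * ∑ n ∈ Finset.Icc 1 M, ArithmeticFunction.vonMangoldt n / Real.sqrt n) := by
  have ht : 0 ≤ t := hu.trans hut
  have htM' : Real.exp |t| ≤ M := by rwa [abs_of_nonneg ht]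
  have huM' : Real.exp |u| ≤ M := by
    rw [abs_of_nonneg hu]
    exact (Real.exp_le_exp.2 hut).trans htM
  rw [zetaScrewPrimeSum_eq_sum_max htM', zetaScrewPrimeSum_eq_sum_max huM', abs_of_nonneg ht,
    abs_of_nonneg hu, ← Finset.sum_sub_distrib, Finset.mul_sum]
  have hc : ∀ n : ℕ, 0 ≤ ArithmeticFunction.vonMangoldt n / Real.sqrt n := fun n ↦
    div_nonneg ArithmeticFunction.vonMangoldt_nonneg (Real.sqrt_nonneg _)
  constructor
  · refine Finset.sum_nonneg fun n _ ↦ ?_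
    rw [← mul_sub]
    refine mul_nonneg (hc n) ?_
    rw [sub_nonneg]
    exact max_le_max (by linarith) le_rfl
  · refine Finset.sum_le_sum fun n _ ↦ ?_
    rw [← mul_sub, mul_comm (t - u)]
    refine mul_le_mul_of_nonneg_left ?_ (hc n)
    rw [sub_le_iff_le_add]
    exact max_le (by linarith [le_max_left (u - Real.log n) 0])
      (by linarith [le_max_right (u - Real.log n) 0])

/-- `Σ_{1 ≤ n ≤ M} Λ(n)/√n ≤ 2M` (termwise `Λ(n) ≤ log n ≤ 2√n`; the crude bound of
`IntegerScrewDiscreteLandau.nodeSlack`). -/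
theorem sum_vonMangoldt_div_sqrt_le_two_mul (M : ℕ) :
    ∑ n ∈ Finset.Icc 1 M, ArithmeticFunction.vonMangoldt n / Real.sqrt n ≤ 2 * M := by
  have hterm : ∀ n ∈ Finset.Icc 1 M, ArithmeticFunction.vonMangoldt n / Real.sqrt n ≤ 2 := by
    intro n hn
    have hn1 : 1 ≤ n := (Finset.mem_Icc.1 hn).1
    have hn0 : (0 : ℝ) < n := by exact_mod_cast hn1
    have hsq : 0 < Real.sqrt n := Real.sqrt_pos.2 hn0
    rw [div_le_iff₀ hsq]
    calc (ArithmeticFunction.vonMangoldt n : ℝ) ≤ Real.log n := ArithmeticFunction.vonMangoldt_le_log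
      _ ≤ (n : ℝ) ^ (1 / 2 : ℝ) / (1 / 2) := Real.log_le_rpow_div hn0.le (by norm_num)
      _ = 2 * Real.sqrt n := by rw [Real.sqrt_eq_rpow]; ring
  calc ∑ n ∈ Finset.Icc 1 M, ArithmeticFunction.vonMangoldt n / Real.sqrt n
      ≤ ∑ n ∈ Finset.Icc 1 M, (2 : ℝ) := Finset.sum_le_sum hterm
    _ = 2 * M := by simp [mul_comm]

/-- The slope constant of the linear term of `Ψ`, `c₀ = γ₀ + π/2 + 3 log 2 + log π`
(`= -((Γ'/Γ)(¼) - log π)`, Gauss), lies in `[0, 8]` (`½ < γ₀ < ⅔`, `3 < π < 3.15`, `log 2 < 0.7`,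
`log π ≤ π - 1`). -/
theorem linearCoeff_mem_Icc :
    Real.eulerMascheroniConstant + Real.pi / 2 + 3 * Real.log 2 + Real.log Real.pi ∈
      Set.Icc (0 : ℝ) 8 := by
  have h0 := Real.one_half_lt_eulerMascheroniConstant
  have h1 := Real.eulerMascheroniConstant_lt_two_thirds
  have h2 := Real.pi_lt_d2
  have h2' := Real.pi_gt_three
  have h3 := Real.log_two_lt_d9
  have h3' := Real.log_two_gt_d9
  have h4 := Real.log_le_sub_one_of_pos Real.pi_pos
  have h4' : 0 ≤ Real.log Real.pi := Real.log_nonneg (by linarith)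
  norm_num at h1 h2 h3 h3'
  constructor <;> linarith

/-! ## One-sided oscillation bounds for `Ψ` on `[0, ∞)` -/

/-- **Oscillation of `Ψ` from above.** For `0 ≤ u ≤ t`,
`Ψ(t) - Ψ(u) ≤ 2 e^{t/2} (t - u) + C/4`, `C = Σ_{k ≥ 0} (k + ¼)^{-2}`: in Suzuki2023 (1.1) the
archimedean part rises by `4(e^{t/2} - e^{u/2}) + 4(e^{-t/2} - e^{-u/2}) ≤ 4 e^{t/2} (t - u)/2`
(convexity of `exp`), the prime sum `φ` is non-decreasing and enters with a minus sign, the linear term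
`-c₀ t/2` decreases (`c₀ ≥ 0`), and the Hurwitz–Lerch part `¼ (C - e^{-t/2} Φ(e^{-2t}, 2, ¼))` stays in
`[0, C/4]`.  RH-free. -/
theorem zetaScrew_sub_le_of_le {u t : ℝ} (hu : 0 ≤ u) (hut : u ≤ t) :
    zetaScrew t - zetaScrew u ≤
      2 * Real.exp (t / 2) * (t - u) + (∑' k : ℕ, 1 / ((k : ℝ) + 1 / 4) ^ 2) / 4 := by
  have ht : 0 ≤ t := hu.trans hut
  -- (1) archimedean part: `e^{t/2} - e^{u/2} ≤ e^{t/2} (t - u)/2` and `e^{-t/2} ≤ e^{-u/2}`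
  have hA1 : Real.exp (t / 2) - Real.exp (u / 2) ≤ Real.exp (t / 2) * ((t - u) / 2) := by
    have h := Real.add_one_le_exp ((u - t) / 2)
    have h' : Real.exp (t / 2) * ((u - t) / 2 + 1) ≤ Real.exp (t / 2) * Real.exp ((u - t) / 2) :=
      mul_le_mul_of_nonneg_left h (Real.exp_pos _).le
    rw [← Real.exp_add, show t / 2 + (u - t) / 2 = u / 2 by ring] at h'
    nlinarith [h', Real.exp_pos (t / 2)]
  have hA2 : Real.exp (-(t / 2)) ≤ Real.exp (-(u / 2)) := Real.exp_le_exp.2 (by linarith)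
  -- (2) the prime sum is non-decreasing
  have hφ := (zetaScrewPrimeSum_sub_mem_Icc (M := ⌈Real.exp t⌉₊) hu hut (Nat.le_ceil _)).1
  -- (3) the linear term decreases
  have hlin : 0 ≤ (t - u) / 2 *
      (Real.eulerMascheroniConstant + Real.pi / 2 + 3 * Real.log 2 + Real.log Real.pi) :=
    mul_nonneg (by linarith) linearCoeff_mem_Icc.1
  -- (4) the Hurwitz–Lerch part stays in `[0, C]`
  have hH1 : Real.exp (-(u / 2)) * hurwitzLerchQuarter u ≤ ∑' k : ℕ, 1 / ((k : ℝ) + 1 / 4) ^ 2 := by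
    calc Real.exp (-(u / 2)) * hurwitzLerchQuarter u ≤ 1 * hurwitzLerchQuarter u :=
          mul_le_mul_of_nonneg_right (Real.exp_le_one_iff.2 (by linarith))
            (hurwitzLerchQuarter_nonneg u)
      _ ≤ ∑' k : ℕ, 1 / ((k : ℝ) + 1 / 4) ^ 2 := by rw [one_mul]; exact hurwitzLerchQuarter_le u
  have hH2 : 0 ≤ Real.exp (-(t / 2)) * hurwitzLerchQuarter t :=
    mul_nonneg (Real.exp_pos _).le (hurwitzLerchQuarter_nonneg t)
  rw [zetaScrew_eq t, zetaScrew_eq u, abs_of_nonneg ht, abs_of_nonneg hu]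
  linarith [hA1, hA2, hφ, hlin, hH1, hH2]

/-- **Oscillation of `Ψ` from below.** For `0 ≤ u ≤ t` and a natural number `M ≥ e^t`,
`Ψ(u) - Ψ(t) ≤ (t - u)(2M + 4)`: the archimedean part `8(cosh(t/2) - 1)` and the Hurwitz–Lerch part
`-¼ e^{-t/2} Φ(e^{-2t}, 2, ¼)` are non-decreasing on `[0, ∞)`, the prime sum rises by at most
`(t - u) Σ_{n ≤ M} Λ(n)/√n ≤ (t - u) · 2M`, and the linear term falls by `(t - u) c₀/2 ≤ 4 (t - u)`
(`c₀ ≤ 8`).  This is the bookkeeping of the tree's `IntegerScrewDiscreteLandau.nodeSlack` with `u` no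
longer required to be a node.  RH-free. -/
theorem zetaScrew_sub_le_of_le' {u t : ℝ} {M : ℕ} (hu : 0 ≤ u) (hut : u ≤ t)
    (htM : Real.exp t ≤ M) :
    zetaScrew u - zetaScrew t ≤ (t - u) * (2 * M + 4) := by
  have ht : 0 ≤ t := hu.trans hut
  -- (1) the archimedean part `e^{x/2} + e^{-x/2} = 2 cosh(x/2)` is non-decreasing on `[0, ∞)`
  have hA : Real.exp (u / 2) + Real.exp (-(u / 2)) ≤ Real.exp (t / 2) + Real.exp (-(t / 2)) := by
    have h := Real.cosh_le_cosh.2 (show |u / 2| ≤ |t / 2| by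
      rw [abs_of_nonneg (by linarith), abs_of_nonneg (by linarith)]; linarith)
    rw [Real.cosh_eq, Real.cosh_eq] at h
    linarith
  -- (2) the prime sum rises by at most `(t - u) · 2M`
  have hφ : zetaScrewPrimeSum t - zetaScrewPrimeSum u ≤ (t - u) * (2 * M) :=
    (zetaScrewPrimeSum_sub_mem_Icc hu hut htM).2.trans
      (mul_le_mul_of_nonneg_left (sum_vonMangoldt_div_sqrt_le_two_mul M) (by linarith))
  -- (3) the linear term: `c₀ ≤ 8`
  have hlin : (t - u) / 2 *
      (Real.eulerMascheroniConstant + Real.pi / 2 + 3 * Real.log 2 + Real.log Real.pi) ≤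
        (t - u) / 2 * 8 :=
    mul_le_mul_of_nonneg_left linearCoeff_mem_Icc.2 (by linarith)
  -- (4) the Hurwitz–Lerch part `e^{-x/2} Φ(e^{-2x}, 2, 1/4)` is non-increasing on `[0, ∞)`
  have hHle : hurwitzLerchQuarter t ≤ hurwitzLerchQuarter u := by
    unfold hurwitzLerchQuarter
    refine (summable_hurwitzLerchQuarter t).tsum_le_tsum (fun k ↦ ?_)
      (summable_hurwitzLerchQuarter u)
    apply div_le_div_of_nonneg_right ?_ (by positivity)
    apply Real.exp_le_exp.2
    rw [abs_of_nonneg ht, abs_of_nonneg hu]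
    have hk : (0 : ℝ) ≤ k := Nat.cast_nonneg k
    nlinarith
  have hH : Real.exp (-(t / 2)) * hurwitzLerchQuarter t ≤
      Real.exp (-(u / 2)) * hurwitzLerchQuarter u :=
    mul_le_mul (Real.exp_le_exp.2 (by linarith)) hHle (hurwitzLerchQuarter_nonneg t)
      (Real.exp_pos _).le
  rw [zetaScrew_eq u, zetaScrew_eq t, abs_of_nonneg hu, abs_of_nonneg ht]
  linarith [hA, hH, hφ, hlin]

/-! ## The two registered stubs of line «TwoScaleSlack» -/

/-- Cell bookkeeping: for `x ≥ 0` and `m = ⌊e^x⌋`, `m ≥ 1`, `0 ≤ log m ≤ x` and `x - log m ≤ 1/m`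
(`x < log (m+1)` and `log (m+1) - log m = log (1 + 1/m) ≤ 1/m`), and `e^x < m + 1`. -/
theorem floor_exp_cell {x : ℝ} (hx : 0 ≤ x) :
    1 ≤ ⌊Real.exp x⌋₊ ∧ 0 ≤ Real.log (⌊Real.exp x⌋₊ : ℝ) ∧ Real.log (⌊Real.exp x⌋₊ : ℝ) ≤ x ∧
      x - Real.log (⌊Real.exp x⌋₊ : ℝ) ≤ 1 / (⌊Real.exp x⌋₊ : ℝ) ∧
        Real.exp x < (⌊Real.exp x⌋₊ : ℝ) + 1 := by
  generalize hm : ⌊Real.exp x⌋₊ = m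
  have hm1 : 1 ≤ m := hm ▸ (Nat.one_le_floor_iff _).2 (Real.one_le_exp hx)
  have hmpos : (0 : ℝ) < m := by exact_mod_cast hm1
  have hm0 : (m : ℝ) ≠ 0 := hmpos.ne'
  have hm_le : (m : ℝ) ≤ Real.exp x := by rw [← hm]; exact Nat.floor_le (Real.exp_pos x).le
  have hx_lt : Real.exp x < (m : ℝ) + 1 := by rw [← hm]; exact Nat.lt_floor_add_one _
  have hu0 : 0 ≤ Real.log (m : ℝ) := Real.log_nonneg (by exact_mod_cast hm1)
  have hux : Real.log (m : ℝ) ≤ x := by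
    calc Real.log m ≤ Real.log (Real.exp x) := Real.log_le_log hmpos hm_le
      _ = x := Real.log_exp x
  have hx_lt_log : x < Real.log ((m : ℝ) + 1) := (Real.lt_log_iff_exp_lt (by positivity)).2 hx_lt
  have hlog1 : Real.log ((m : ℝ) + 1) - Real.log m ≤ 1 / m := by
    rw [← Real.log_div (by positivity) hm0]
    have h := Real.log_le_sub_one_of_pos (show (0 : ℝ) < ((m : ℝ) + 1) / m by positivity)
    have h' : ((m : ℝ) + 1) / m - 1 = 1 / m := by
      rw [div_sub_one hm0]
      congr 1
      ring
    linarith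
  exact ⟨hm1, hu0, hux, by linarith, hx_lt⟩

/-- **Stub `stub_upperNodeSlack`** (line «TwoScaleSlack» of crux `SquaringNodes`, registered on
stmt-RiemannHypothesis-23895): node slack from ABOVE, `Ψ(s) ≤ Ψ(log ⌊e^s⌋) + C₁` for all `s ≥ 0`, with
`C₁ = 4 + C/4`.  On the cell of `s`, `m = ⌊e^s⌋ ≥ 1`: `s - log m ≤ 1/m` and `e^{s/2} ≤ e^s < m + 1`, so
`zetaScrew_sub_le_of_le` gives `Ψ(s) - Ψ(log m) ≤ 2(m+1)/m + C/4 ≤ 4 + C/4`.  RH-free. -/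
theorem stub_upperNodeSlack : ∃ C : ℝ, ∀ s : ℝ, 0 ≤ s →
    zetaScrew s ≤ zetaScrew (Real.log ⌊Real.exp s⌋₊) + C := by
  refine ⟨4 + (∑' k : ℕ, 1 / ((k : ℝ) + 1 / 4) ^ 2) / 4, fun s hs ↦ ?_⟩
  obtain ⟨hm1, hu0, hus, hsu, hs_lt⟩ := floor_exp_cell hs
  generalize hm : ⌊Real.exp s⌋₊ = m at hm1 hu0 hus hsu hs_lt ⊢
  have hmpos : (0 : ℝ) < m := by exact_mod_cast hm1
  have hm1' : (1 : ℝ) ≤ m := by exact_mod_cast hm1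
  have hexp : Real.exp (s / 2) ≤ (m : ℝ) + 1 :=
    (Real.exp_le_exp.2 (by linarith : s / 2 ≤ s)).trans hs_lt.le
  have hmain := zetaScrew_sub_le_of_le hu0 hus
  have hprod : 2 * Real.exp (s / 2) * (s - Real.log m) ≤ 2 * ((m : ℝ) + 1) * (1 / m) :=
    mul_le_mul (by linarith) hsu (by linarith) (by positivity)
  have h4 : 2 * ((m : ℝ) + 1) * (1 / m) ≤ 4 := by
    rw [mul_one_div, div_le_iff₀ hmpos]
    linarith
  linarith

/-- **Stub `stub_halfNodeSlack`** (line «TwoScaleSlack» of crux `SquaringNodes`, registered on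
stmt-RiemannHypothesis-23895): two-sided slack between `t ≥ 0` and the half-node `u = ½ log ⌊e^{2t}⌋`,
`|Ψ(t) - Ψ(u)| ≤ C₂` with `C₂ = 4 + C/4`.  With `m = ⌊e^{2t}⌋ ≥ 1`: `0 ≤ t - u ≤ 1/(2m)` and
`e^{t/2} ≤ e^t ≤ e^{2t} < m + 1`, so `zetaScrew_sub_le_of_le` gives `Ψ(t) - Ψ(u) ≤ (m+1)/m + C/4 ≤ 2 + C/4`
and `zetaScrew_sub_le_of_le'` with `M = m + 1` gives `Ψ(u) - Ψ(t) ≤ (2m + 6)/(2m) ≤ 4`.  RH-free. -/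
theorem stub_halfNodeSlack : ∃ C : ℝ, ∀ t : ℝ, 0 ≤ t →
    |zetaScrew t - zetaScrew (Real.log ⌊Real.exp (2 * t)⌋₊ / 2)| ≤ C := by
  have hC0 : 0 ≤ ∑' k : ℕ, 1 / ((k : ℝ) + 1 / 4) ^ 2 := tsum_nonneg fun k ↦ by positivity
  refine ⟨4 + (∑' k : ℕ, 1 / ((k : ℝ) + 1 / 4) ^ 2) / 4, fun t ht ↦ ?_⟩
  have h2t : 0 ≤ 2 * t := by positivity
  obtain ⟨hm1, hlog0, hlog_le, hlog_sub, ht_lt⟩ := floor_exp_cell h2t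
  generalize hm : ⌊Real.exp (2 * t)⌋₊ = m at hm1 hlog0 hlog_le hlog_sub ht_lt ⊢
  have hmpos : (0 : ℝ) < m := by exact_mod_cast hm1
  have hm1' : (1 : ℝ) ≤ m := by exact_mod_cast hm1
  set u : ℝ := Real.log (m : ℝ) / 2 with hu
  have hu0 : 0 ≤ u := by rw [hu]; linarith
  have hut : u ≤ t := by rw [hu]; linarith
  have htu : t - u ≤ 1 / (2 * m) := by
    rw [hu]
    calc t - Real.log m / 2 ≤ (1 / m) / 2 := by linarith
      _ = 1 / (2 * m) := by ring
  have hexp : Real.exp (t / 2) ≤ (m : ℝ) + 1 :=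
    (Real.exp_le_exp.2 (by linarith : t / 2 ≤ 2 * t)).trans ht_lt.le
  have hexp' : Real.exp t ≤ ((m + 1 : ℕ) : ℝ) := by
    push_cast
    exact (Real.exp_le_exp.2 (by linarith : t ≤ 2 * t)).trans ht_lt.le
  -- from above
  have hup := zetaScrew_sub_le_of_le hu0 hut
  have hprod : 2 * Real.exp (t / 2) * (t - u) ≤ 2 * ((m : ℝ) + 1) * (1 / (2 * m)) :=
    mul_le_mul (by linarith) htu (by linarith) (by positivity)
  have h2 : 2 * ((m : ℝ) + 1) * (1 / (2 * m)) ≤ 2 := by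
    rw [mul_one_div, div_le_iff₀ (by positivity)]
    linarith
  -- from below
  have hlow := zetaScrew_sub_le_of_le' hu0 hut hexp'
  have hprod' : (t - u) * (2 * ((m + 1 : ℕ) : ℝ) + 4) ≤ 1 / (2 * m) * (2 * ((m + 1 : ℕ) : ℝ) + 4) :=
    mul_le_mul_of_nonneg_right htu (by positivity)
  have h4 : 1 / (2 * (m : ℝ)) * (2 * ((m + 1 : ℕ) : ℝ) + 4) ≤ 4 := by
    push_cast
    rw [one_div_mul_eq_div, div_le_iff₀ (by positivity)]
    linarith
  rw [abs_le]
  constructor <;> linarith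

/-! ## The crux by name -/

/-- **Crux `ScrewSquaringLaw.SquaringNodes` (stmt-RiemannHypothesis-23895) holds** — SQUARING NODES
(K1′, RH-free): a floor of the doubling defect of Suzuki's screw function at the integer nodes,
`Ψ(log m) ≤ 4Ψ(½ log m) + K` for all `m ≥ 1`, is a floor on the continuum, `Ψ(2t) ≤ 4Ψ(t) + K'` for all
`t ≥ 0` (`K' = K + C₁ + 4C₂`).  For `t ≥ 0` take the node `m = ⌊e^{2t}⌋ ≥ 1`: `stub_upperNodeSlack` at
`s = 2t` gives `Ψ(2t) ≤ Ψ(log m) + C₁`, the hypothesis gives `Ψ(log m) ≤ 4Ψ(½ log m) + K`, and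
`stub_halfNodeSlack` gives `Ψ(½ log m) ≤ Ψ(t) + C₂` (composition = the planner's kernel-checked
`SquaringNodes_of`).  A transfer lemma inside an RH-criterion route; RH is NOT proved by this and
nothing here bears on the truth of RH. -/
theorem squaringNodes_proof :
    Summit.RiemannHypothesis.RiemannHypothesis.Theses.ScrewSquaringLaw.SquaringNodes := by
  unfold Summit.RiemannHypothesis.RiemannHypothesis.Theses.ScrewSquaringLaw.SquaringNodes
  rintro ⟨K, hK⟩
  obtain ⟨C₁, hC₁⟩ := stub_upperNodeSlack
  obtain ⟨C₂, hC₂⟩ := stub_halfNodeSlack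
  refine ⟨K + C₁ + 4 * C₂, fun t ht ↦ ?_⟩
  have h2t : 0 ≤ 2 * t := by positivity
  have hm : 1 ≤ ⌊Real.exp (2 * t)⌋₊ := (Nat.one_le_floor_iff _).2 (Real.one_le_exp h2t)
  have hnode := hK _ hm
  have hup := hC₁ (2 * t) h2t
  have hhalf := (abs_le.1 (hC₂ t ht)).1
  linarith

end Summit.RiemannHypothesis.RiemannHypothesis.Theorems.ScrewSquaringLaw

end
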